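import Summits.QuantumFields.YangMills.Theorems.BalabanUVNodesN19DiscreteJacksonTensor

/-!
# YM-DAG node N19 (= NE7 proper) — THE DISCRETE TENSOR JACKSON QUASI-INTERPOLANT, III: Chebyshev pricing; mixed moments ⇒ `2πK|ι|∕m + G(m·9^m)^{|ι|}r`

Cell `pub-ymgap`, HUMAN RULING D-0062 (Track A), R141 (C) wider-strategy seat `pub-ymgap-dag-n19-e` (strategy s3 = ALTERNATIVE CURRENCY), generation
g20, module 3 (lineage module 61).  Route `Summits/QuantumFields/YangMills/Theses/BalabanUVNodes.lean` rev 25, cluster item K3⁷ «SpineGivenEndpointR13SepCoPH»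
(stmt-QuantumFields-20544, dag-lead WORDS-143); filed `--supports` that item `--as helper` (it proves no registered stub).  COUNT-NEUTRAL: [folklore] real
analysis over Mathlib (`Polynomial.Chebyshev.T`, `T_add_two`, `T_neg`, `T_real_cos`, `natDegree_T`) + the lineage BY NAME: modules 59∕60
`…N19DiscreteJackson(Tensor)` (`abs_tensorJackson_sub_le_cube`), module 55 `…N19JointLawBernstein` (`abs_integral_prod_eval_sub_le`,
`integrable_of_continuous_of_cube`), p554543 `…N19LawPriceJackson` (`sum_abs_coeff_X_mul_le`) and p509390 `…N19NoLinearPriceWitness`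
(`sum_abs_coeff_add_le ∕ sub_le ∕ C_mul`); Mathlib-generic, no scheme object; NOT a discharge claim.

THE RESULT.  §1 the Chebyshev polynomials cost `Λ(T_k) = Σ_i |[x^i]T_k| ≤ 3^{|k|}` (`T_{n+2} = 2X·T_{n+1} − T_n`).  §2 the JACKSON NODE POLYNOMIALS
  `Φ_a = C(1∕(N c_m)) · Σ_{x ∈ ([m]²)²} C(cos(k_x θ_a)) · T_{k_x}`,  `k_x = x₁₁ − x₁₂ + x₂₁ − x₂₂`, `θ_a = 2πa∕N`, `c_m = m(2m²+1)∕3`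
(displayed, never named) evaluate at `cos t` to module 60's weight `W_a(t) = (F_m(t − θ_a)² + F_m(t + θ_a)²)∕(2N c_m)` (`fejer_sq_eq` + `T_k(cos t) = cos kt` +
`cos(u − v) + cos(u + v) = 2cos u cos v`), have degree `≤ 2m`, and `Σ_{a<N} Λ(Φ_a) ≤ m·9^m` (`m⁴` frequencies, each `|k_x| ≤ 2m − 2`, `m³ ≤ 9c_m`).  §3 PRICING as
module 55: for laws `P, Q` on `ℝ^ι` carried by `[−1,1]^ι` with mixed moments of coordinate degree `≤ 2m` within `r`, and node values `|c_a| ≤ G`,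
`|∫ Σ_a c_a ∏_i Φ_{a_i}(x_i) d(P − Q)| ≤ G·(m·9^m)^{|ι|}·r`.  §4 ★★ `abs_integral_sub_integral_le_of_mixedMoments_jackson`: for continuous `f` with
`|f u − f v| ≤ K Σ_i|u_i − v_i|` and `|f| ≤ G` on the cube, every `m ≥ 1`:
  `|∫ f dP − ∫ f dQ| ≤ 2πK|ι|∕m + G·(m·9^m)^{|ι|}·r`
— the `m^{−1}` ROAD (module 56 had `2K|ι|∕√n + G·2^{n|ι|}·r`): choosing `m ≍ log r⁻¹∕(|ι| log 9)` gives a bounded-Lipschitz distance `≍ K|ι|²∕log r⁻¹` instead of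
`K|ι|^{3∕2}∕√(log r⁻¹)`.  The scheme sibling (module 62) reads it at `r = R_K` under uniform `Target`; the `d = 1` sibling (module 63) shows `Θ(1∕log r⁻¹)` is
the exact price of uniform moment closeness (binomial witness).

HONEST FRAMING (binding).  [folklore]; Mathlib-generic; NO consumer in the DAG today (it sharpens the lineage's own joint-law rate); nothing of Bałaban's
instantiated; NE7 NOT PRINTED, NOT proved; N19 NOT discharged; count-neutral.  One finite `T⁴` programme at fixed `ε`; nothing continuum ∕ `ℝ⁴` ∕ OS ∕
mass-gap ∕ Clay.  0 `def` ∕ 0 `sorry`.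
-/

noncomputable section

open Real Finset MeasureTheory Polynomial

namespace Summit.QuantumFields.YangMills.Theorems.BalabanUVNodesN19DiscreteJacksonPricing

open Literature.Analysis.Quadrature.Jackson (fejer_sq_eq)
open Summit.QuantumFields.YangMills.Theorems.BalabanUVNodesN19DiscreteJackson (natAbs_jacksonFreq_lt)
open Summit.QuantumFields.YangMills.Theorems.BalabanUVNodesN19DiscreteJacksonTensor (abs_tensorJackson_sub_le_cube)
open Summit.QuantumFields.YangMills.Theorems.BalabanUVNodesN19JointLawBernstein (abs_integral_prod_eval_sub_le integrable_of_continuous_of_cube)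
open Summit.QuantumFields.YangMills.Theorems.BalabanUVNodesN19LawPriceJackson (sum_abs_coeff_X_mul_le)

namespace LPJ
export Summit.QuantumFields.YangMills.Theorems.BalabanUVNodesN19LawPriceJackson (sum_abs_coeff_one)
end LPJ
open Summit.QuantumFields.YangMills.Theorems.BalabanUVNodesN19NoLinearPriceWitness (sum_abs_coeff_add_le sum_abs_coeff_sub_le sum_abs_coeff_C_mul)

/-! ## §1 The Chebyshev polynomials cost `3^{|k|}` in `ℓ¹` coefficient mass [folklore] -/

/-- `Λ_d(T_n) ≤ 3^n` for `n : ℕ` (`T_{n+2} = 2X·T_{n+1} − T_n`: `Λ(T_{n+2}) ≤ 2Λ(T_{n+1}) + Λ(T_n) ≤ 7·3^n`). [folklore] -/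
theorem sum_abs_coeff_chebyshevT_nat_le (d : ℕ) : ∀ n : ℕ, ∑ i ∈ range (d + 1), |(Chebyshev.T ℝ n).coeff i| ≤ 3 ^ n := by
  -- two-step induction with the pair `(n, n+1)`
  have key : ∀ n : ℕ, (∑ i ∈ range (d + 1), |(Chebyshev.T ℝ n).coeff i| ≤ 3 ^ n) ∧
      (∑ i ∈ range (d + 1), |(Chebyshev.T ℝ ((n + 1 : ℕ) : ℤ)).coeff i| ≤ 3 ^ (n + 1)) := by
    intro n
    induction n with
    | zero =>
      refine ⟨?_, ?_⟩
      · rw [Nat.cast_zero, Chebyshev.T_zero, LPJ.sum_abs_coeff_one, pow_zero]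
      · rw [Nat.cast_one, Chebyshev.T_one, ← mul_one (X : ℝ[X]), zero_add, pow_one]
        exact (sum_abs_coeff_X_mul_le 1 d).trans (by rw [LPJ.sum_abs_coeff_one]; norm_num)
    | succ n ih =>
      refine ⟨ih.2, ?_⟩
      have hrec : Chebyshev.T ℝ (((n + 1 + 1 : ℕ) : ℤ)) = 2 * X * Chebyshev.T ℝ ((n + 1 : ℕ) : ℤ) - Chebyshev.T ℝ (n : ℤ) := by
        have h := Chebyshev.T_add_two ℝ (n : ℤ)
        push_cast at h ⊢
        exact h
      rw [hrec]
      calc ∑ i ∈ range (d + 1), |(2 * X * Chebyshev.T ℝ ((n + 1 : ℕ) : ℤ) - Chebyshev.T ℝ (n : ℤ)).coeff i|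
          ≤ ∑ i ∈ range (d + 1), |(2 * X * Chebyshev.T ℝ ((n + 1 : ℕ) : ℤ)).coeff i| +
              ∑ i ∈ range (d + 1), |(Chebyshev.T ℝ (n : ℤ)).coeff i| := sum_abs_coeff_sub_le _ _ _
        _ ≤ 2 * 3 ^ (n + 1) + 3 ^ n := by
            refine add_le_add ?_ ih.1
            rw [mul_assoc, two_mul]
            have hX := (sum_abs_coeff_X_mul_le (Chebyshev.T ℝ ((n + 1 : ℕ) : ℤ)) d).trans ih.2
            exact (sum_abs_coeff_add_le _ _ _).trans (by linarith)
        _ ≤ 3 ^ (n + 1 + 1) := by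
            rw [pow_succ, pow_succ, pow_succ]
            have : (0 : ℝ) ≤ 3 ^ n := by positivity
            nlinarith
  exact fun n => (key n).1

/-- **`Λ_d(T_k) ≤ 3^{|k|}` for every `k : ℤ`** (`T_{−n} = T_n`). [folklore] -/
theorem sum_abs_coeff_chebyshevT_le (d : ℕ) (k : ℤ) : ∑ i ∈ range (d + 1), |(Chebyshev.T ℝ k).coeff i| ≤ 3 ^ k.natAbs := by
  obtain ⟨n, rfl | rfl⟩ := Int.eq_nat_or_neg k
  · simpa using sum_abs_coeff_chebyshevT_nat_le d n
  · rw [Chebyshev.T_neg, Int.natAbs_neg]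
    simpa using sum_abs_coeff_chebyshevT_nat_le d n

/-- `Λ_d` of a finite sum is at most the sum of the `Λ_d`'s. [folklore] -/
theorem sum_abs_coeff_finsetSum_le {α : Type*} (s : Finset α) (p : α → ℝ[X]) (d : ℕ) :
    ∑ i ∈ range (d + 1), |(∑ x ∈ s, p x).coeff i| ≤ ∑ x ∈ s, ∑ i ∈ range (d + 1), |(p x).coeff i| := by
  classical
  induction s using Finset.induction_on with
  | empty => simp
  | @insert x s hx ih =>
    rw [Finset.sum_insert hx, Finset.sum_insert hx]
    exact (sum_abs_coeff_add_le _ _ _).trans (add_le_add le_rfl ih)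

/-! ## §2 The Jackson node polynomials `Φ_a`: evaluation at `cos t`, degree, `ℓ¹` mass [folklore] -/

/-- **EVALUATION**: `Φ_a(cos t) = W_a(t)` — the symmetrised Jackson weight of module 60 (`fejer_sq_eq`, `T_k(cos t) = cos(kt)`,
`cos(kt − kθ) + cos(kt + kθ) = 2cos(kt)cos(kθ)`). [folklore] -/
theorem eval_jacksonPoly_cos (m N a : ℕ) (t : ℝ) :
    (C (1 / ((N : ℝ) * (m * (2 * m ^ 2 + 1) / 3))) *
        ∑ x ∈ (range m ×ˢ range m) ×ˢ (range m ×ˢ range m),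
          C (Real.cos ((((x.1.1 : ℤ) - x.1.2 + x.2.1 - x.2.2 : ℤ) : ℝ) * (2 * π * a / N))) *
            Chebyshev.T ℝ ((x.1.1 : ℤ) - x.1.2 + x.2.1 - x.2.2)).eval (Real.cos t) =
      ((∑ j₁ ∈ range m, ∑ j₂ ∈ range m, Real.cos (((j₁ : ℝ) - j₂) * (t - 2 * π * a / N))) ^ 2 +
          (∑ j₁ ∈ range m, ∑ j₂ ∈ range m, Real.cos (((j₁ : ℝ) - j₂) * (t + 2 * π * a / N))) ^ 2) /
        (2 * N * (m * (2 * m ^ 2 + 1) / 3)) := by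
  rw [fejer_sq_eq, fejer_sq_eq, ← Finset.sum_add_distrib, eval_mul, eval_C, eval_finsetSum]
  have hterm : ∀ x ∈ (range m ×ˢ range m) ×ˢ (range m ×ˢ range m),
      (C (Real.cos ((((x.1.1 : ℤ) - x.1.2 + x.2.1 - x.2.2 : ℤ) : ℝ) * (2 * π * a / N))) *
          Chebyshev.T ℝ ((x.1.1 : ℤ) - x.1.2 + x.2.1 - x.2.2)).eval (Real.cos t) =
        (Real.cos ((((x.1.1 : ℤ) - x.1.2 + x.2.1 - x.2.2 : ℤ) : ℝ) * (t - 2 * π * a / N)) +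
          Real.cos ((((x.1.1 : ℤ) - x.1.2 + x.2.1 - x.2.2 : ℤ) : ℝ) * (t + 2 * π * a / N))) / 2 := by
    intro x _
    rw [eval_mul, eval_C, Chebyshev.T_real_cos, mul_sub, mul_add, Real.cos_sub, Real.cos_add]
    ring
  rw [Finset.sum_congr rfl hterm, ← Finset.sum_div, one_div_mul_eq_div, div_div, ← mul_assoc]

/-- **DEGREE**: `deg Φ_a ≤ 2m` (each `|k_x| ≤ 2m − 2`, Mathlib `natDegree_T`). [bookkeeping] -/
theorem natDegree_jacksonPoly_le (m N a : ℕ) :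
    (C (1 / ((N : ℝ) * (m * (2 * m ^ 2 + 1) / 3))) *
        ∑ x ∈ (range m ×ˢ range m) ×ˢ (range m ×ˢ range m),
          C (Real.cos ((((x.1.1 : ℤ) - x.1.2 + x.2.1 - x.2.2 : ℤ) : ℝ) * (2 * π * a / N))) *
            Chebyshev.T ℝ ((x.1.1 : ℤ) - x.1.2 + x.2.1 - x.2.2)).natDegree ≤ 2 * m := by
  refine (natDegree_C_mul_le _ _).trans (natDegree_sum_le_of_forall_le _ _ fun x hx => ?_)
  refine (natDegree_C_mul_le _ _).trans ?_
  rw [Chebyshev.natDegree_T]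
  exact (natAbs_jacksonFreq_lt (le_refl (2 * m)) hx).le

/-- **`ℓ¹` MASS**: `Λ_d(Φ_a) ≤ m⁴·9^m∕(9·N·c_m)` … packaged below as `Σ_{a<N} Λ_d(Φ_a) ≤ m·9^m`; here the per-node bound
`Λ_d(Φ_a) ≤ (1∕(N c_m))·Σ_x 3^{|k_x|}`. [folklore] -/
theorem sum_abs_coeff_jacksonPoly_le (m N a d : ℕ) :
    ∑ i ∈ range (d + 1), |(C (1 / ((N : ℝ) * (m * (2 * m ^ 2 + 1) / 3))) *
        ∑ x ∈ (range m ×ˢ range m) ×ˢ (range m ×ˢ range m),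
          C (Real.cos ((((x.1.1 : ℤ) - x.1.2 + x.2.1 - x.2.2 : ℤ) : ℝ) * (2 * π * a / N))) *
            Chebyshev.T ℝ ((x.1.1 : ℤ) - x.1.2 + x.2.1 - x.2.2)).coeff i| ≤
      1 / (N * (m * (2 * m ^ 2 + 1) / 3)) *
        ∑ x ∈ (range m ×ˢ range m) ×ˢ (range m ×ˢ range m), (3 : ℝ) ^ ((x.1.1 : ℤ) - x.1.2 + x.2.1 - x.2.2).natAbs := by
  rw [sum_abs_coeff_C_mul, abs_of_nonneg (by positivity)]
  refine mul_le_mul_of_nonneg_left ((sum_abs_coeff_finsetSum_le _ _ d).trans (Finset.sum_le_sum fun x _ => ?_)) (by positivity)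
  rw [sum_abs_coeff_C_mul]
  exact (mul_le_mul (Real.abs_cos_le_one _) (sum_abs_coeff_chebyshevT_le d _) (Finset.sum_nonneg fun _ _ => abs_nonneg _)
    zero_le_one).trans (by rw [one_mul])

/-- **`Σ_{a<N} Λ_d(Φ_a) ≤ m·9^m`** (`m ≥ 1`, `N ≥ 1`): `m⁴` frequencies with `3^{|k_x|} ≤ 9^m∕9`, and `m³ ≤ 9c_m = 3m(2m²+1)`. [folklore] -/
theorem sum_sum_abs_coeff_jacksonPoly_le {m N : ℕ} (hm : 0 < m) (hN : 0 < N) (d : ℕ) :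
    ∑ a ∈ range N, ∑ i ∈ range (d + 1), |(C (1 / ((N : ℝ) * (m * (2 * m ^ 2 + 1) / 3))) *
        ∑ x ∈ (range m ×ˢ range m) ×ˢ (range m ×ˢ range m),
          C (Real.cos ((((x.1.1 : ℤ) - x.1.2 + x.2.1 - x.2.2 : ℤ) : ℝ) * (2 * π * a / N))) *
            Chebyshev.T ℝ ((x.1.1 : ℤ) - x.1.2 + x.2.1 - x.2.2)).coeff i| ≤ (m : ℝ) * 9 ^ m := by
  have hmr : (0 : ℝ) < m := Nat.cast_pos.2 hm
  have hNr : (0 : ℝ) < N := Nat.cast_pos.2 hN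
  -- each frequency costs at most `9^m ∕ 9 = 3^{2m−2}`
  have hfreq : ∀ x ∈ (range m ×ˢ range m) ×ˢ (range m ×ˢ range m),
      (3 : ℝ) ^ ((x.1.1 : ℤ) - x.1.2 + x.2.1 - x.2.2).natAbs ≤ 9 ^ m / 9 := by
    intro x hx
    have hk : ((x.1.1 : ℤ) - x.1.2 + x.2.1 - x.2.2).natAbs ≤ 2 * (m - 1) := by
      simp only [Finset.mem_product, Finset.mem_range] at hx
      omega
    have h9 : (9 : ℝ) ^ m / 9 = 3 ^ (2 * (m - 1)) := by
      rw [pow_mul, show (3 : ℝ) ^ 2 = 9 by norm_num]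
      obtain ⟨k, rfl⟩ := Nat.exists_eq_succ_of_ne_zero hm.ne'
      rw [Nat.succ_sub_one, pow_succ]
      field_simp
    rw [h9]
    exact pow_le_pow_right₀ (by norm_num) hk
  have hcard : (((range m ×ˢ range m) ×ˢ (range m ×ˢ range m)).card : ℝ) = (m : ℝ) ^ 4 := by
    simp only [Finset.card_product, Finset.card_range]
    push_cast
    ring
  calc ∑ a ∈ range N, ∑ i ∈ range (d + 1), |(C (1 / ((N : ℝ) * (m * (2 * m ^ 2 + 1) / 3))) *
          ∑ x ∈ (range m ×ˢ range m) ×ˢ (range m ×ˢ range m),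
            C (Real.cos ((((x.1.1 : ℤ) - x.1.2 + x.2.1 - x.2.2 : ℤ) : ℝ) * (2 * π * a / N))) *
              Chebyshev.T ℝ ((x.1.1 : ℤ) - x.1.2 + x.2.1 - x.2.2)).coeff i|
      ≤ ∑ _a ∈ range N, 1 / (N * (m * (2 * m ^ 2 + 1) / 3)) * (((m : ℝ) ^ 4) * (9 ^ m / 9)) :=
        Finset.sum_le_sum fun a _ => (sum_abs_coeff_jacksonPoly_le m N a d).trans
          (mul_le_mul_of_nonneg_left (by
            rw [← hcard, ← nsmul_eq_mul, ← Finset.sum_const]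
            exact Finset.sum_le_sum hfreq) (by positivity))
    _ = (m : ℝ) ^ 3 / (3 * (2 * m ^ 2 + 1)) * 9 ^ m := by
        rw [Finset.sum_const, Finset.card_range, nsmul_eq_mul]
        field_simp
        ring
    _ ≤ (m : ℝ) * 9 ^ m := by
        refine mul_le_mul_of_nonneg_right ?_ (by positivity)
        rw [div_le_iff₀ (by positivity)]
        nlinarith [sq_nonneg (m : ℝ), hmr]

variable {ι : Type*} [Fintype ι] [DecidableEq ι]

/-! ## §3 Pricing the discrete tensor Jackson polynomial at the mixed moments [folklore] -/

/-- ★ **PRICING THE TENSOR JACKSON POLYNOMIAL**: two probability laws `P`, `Q` on `ℝ^ι` carried by `[−1,1]^ι` whose mixed moments of coordinate degrees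
`≤ 2m` differ by at most `r ≥ 0`; node values `|c_a| ≤ G`; `m, N ≥ 1`.  Then `|∫ Σ_a c_a ∏_i Φ_{a_i}(x_i) dP − ∫ … dQ| ≤ G·(m·9^m)^{|ι|}·r`
(module 55 `abs_integral_prod_eval_sub_le` per node, `Fintype.prod_sum`, §2). -/
theorem abs_integral_tensorJackson_sub_le {P Q : Measure (ι → ℝ)} [IsProbabilityMeasure P] [IsProbabilityMeasure Q]
    (hP : P (Set.pi Set.univ (fun _ : ι => Set.Icc (-1 : ℝ) 1))ᶜ = 0) (hQ : Q (Set.pi Set.univ (fun _ : ι => Set.Icc (-1 : ℝ) 1))ᶜ = 0)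
    {m N : ℕ} (hm : 0 < m) (hN : 0 < N) {r : ℝ} (hr : 0 ≤ r)
    (hmom : ∀ j : ι → Fin (2 * m + 1), |∫ x, ∏ i, x i ^ (j i : ℕ) ∂P - ∫ x, ∏ i, x i ^ (j i : ℕ) ∂Q| ≤ r)
    {c : (ι → Fin N) → ℝ} {G : ℝ} (hc : ∀ a, |c a| ≤ G) :
    |∫ x, ∑ a : ι → Fin N, c a * ∏ i, (C (1 / ((N : ℝ) * (m * (2 * m ^ 2 + 1) / 3))) *
          ∑ y ∈ (range m ×ˢ range m) ×ˢ (range m ×ˢ range m),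
            C (Real.cos ((((y.1.1 : ℤ) - y.1.2 + y.2.1 - y.2.2 : ℤ) : ℝ) * (2 * π * (a i : ℕ) / N))) *
              Chebyshev.T ℝ ((y.1.1 : ℤ) - y.1.2 + y.2.1 - y.2.2)).eval (x i) ∂P -
      ∫ x, ∑ a : ι → Fin N, c a * ∏ i, (C (1 / ((N : ℝ) * (m * (2 * m ^ 2 + 1) / 3))) *
          ∑ y ∈ (range m ×ˢ range m) ×ˢ (range m ×ˢ range m),
            C (Real.cos ((((y.1.1 : ℤ) - y.1.2 + y.2.1 - y.2.2 : ℤ) : ℝ) * (2 * π * (a i : ℕ) / N))) *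
              Chebyshev.T ℝ ((y.1.1 : ℤ) - y.1.2 + y.2.1 - y.2.2)).eval (x i) ∂Q| ≤
      G * (m * 9 ^ m) ^ Fintype.card ι * r := by
  classical
  have hG : 0 ≤ G := (abs_nonneg _).trans (hc fun _ => ⟨0, hN⟩)
  -- the node polynomials, coordinate by coordinate
  set Φ : ℕ → ℝ[X] := fun b => C (1 / ((N : ℝ) * (m * (2 * m ^ 2 + 1) / 3))) *
      ∑ y ∈ (range m ×ˢ range m) ×ˢ (range m ×ˢ range m),
        C (Real.cos ((((y.1.1 : ℤ) - y.1.2 + y.2.1 - y.2.2 : ℤ) : ℝ) * (2 * π * b / N))) *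
          Chebyshev.T ℝ ((y.1.1 : ℤ) - y.1.2 + y.2.1 - y.2.2) with hΦ
  show |∫ x, ∑ a : ι → Fin N, c a * ∏ i, (Φ (a i)).eval (x i) ∂P - ∫ x, ∑ a : ι → Fin N, c a * ∏ i, (Φ (a i)).eval (x i) ∂Q| ≤ _
  have hcont : ∀ a : ι → Fin N, Continuous fun x : ι → ℝ => ∏ i, (Φ (a i)).eval (x i) := fun a =>
    continuous_finsetProd _ fun i _ => (Polynomial.continuous _).comp (continuous_apply i)
  have hIP : ∀ a : ι → Fin N, Integrable (fun x : ι → ℝ => c a * ∏ i, (Φ (a i)).eval (x i)) P := fun a =>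
    (integrable_of_continuous_of_cube hP (hcont a)).const_mul _
  have hIQ : ∀ a : ι → Fin N, Integrable (fun x : ι → ℝ => c a * ∏ i, (Φ (a i)).eval (x i)) Q := fun a =>
    (integrable_of_continuous_of_cube hQ (hcont a)).const_mul _
  -- per node: priced by the product of the `ℓ¹` masses
  have hprice : ∀ a : ι → Fin N, |∫ x, ∏ i, (Φ (a i)).eval (x i) ∂P - ∫ x, ∏ i, (Φ (a i)).eval (x i) ∂Q| ≤
      (∏ i, ∑ l ∈ range (2 * m + 1), |(Φ (a i)).coeff l|) * r := fun a =>
    abs_integral_prod_eval_sub_le hP hQ hmom (fun i => Φ (a i)) fun i => natDegree_jacksonPoly_le m N (a i)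
  rw [integral_finsetSum _ fun a _ => hIP a, integral_finsetSum _ fun a _ => hIQ a, ← Finset.sum_sub_distrib]
  calc |∑ a : ι → Fin N, (∫ x, c a * ∏ i, (Φ (a i)).eval (x i) ∂P - ∫ x, c a * ∏ i, (Φ (a i)).eval (x i) ∂Q)|
      ≤ ∑ a : ι → Fin N, |∫ x, c a * ∏ i, (Φ (a i)).eval (x i) ∂P - ∫ x, c a * ∏ i, (Φ (a i)).eval (x i) ∂Q| :=
        abs_sum_le_sum_abs _ _
    _ ≤ ∑ a : ι → Fin N, G * ((∏ i, ∑ l ∈ range (2 * m + 1), |(Φ (a i)).coeff l|) * r) := Finset.sum_le_sum fun a _ => by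
        rw [integral_const_mul, integral_const_mul, ← mul_sub, abs_mul]
        exact mul_le_mul (hc a) (hprice a) (abs_nonneg _) hG
    _ = G * (∑ a : ι → Fin N, ∏ i, ∑ l ∈ range (2 * m + 1), |(Φ (a i)).coeff l|) * r := by
        rw [← Finset.mul_sum, ← Finset.sum_mul, mul_assoc]
    _ = G * (∏ _i : ι, ∑ b : Fin N, ∑ l ∈ range (2 * m + 1), |(Φ (b : ℕ)).coeff l|) * r := by
        rw [← Fintype.prod_sum (fun (_ : ι) (b : Fin N) => ∑ l ∈ range (2 * m + 1), |(Φ (b : ℕ)).coeff l|)]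
    _ ≤ G * (m * 9 ^ m) ^ Fintype.card ι * r := by
        refine mul_le_mul_of_nonneg_right (mul_le_mul_of_nonneg_left ?_ hG) hr
        rw [← Finset.card_univ, ← Finset.prod_const]
        refine Finset.prod_le_prod (fun i _ => Finset.sum_nonneg fun b _ => Finset.sum_nonneg fun _ _ => abs_nonneg _) fun i _ => ?_
        rw [Fin.sum_univ_eq_sum_range (fun b => ∑ l ∈ range (2 * m + 1), |(Φ b).coeff l|) N]
        exact sum_sum_abs_coeff_jacksonPoly_le hm hN (2 * m)

/-! ## §4 ★★ Mixed moments `r`-close up to coordinate degree `2m` ⇒ `2πK|ι|∕m + G·(m·9^m)^{|ι|}·r`-close on Lipschitz functions -/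

/-- ★★ **FROM MIXED MOMENTS TO LIPSCHITZ OBSERVABLES ON THE CUBE — THE `m⁻¹` ROAD** [folklore]: probability laws `P`, `Q` on `ℝ^ι` carried by `[−1,1]^ι` with
`|∫ ∏_i x_i^{j_i} dP − ∫ ∏_i x_i^{j_i} dQ| ≤ r` for all `j : ι → {0..2m}` (`m ≥ 1`, `0 ≤ r`); `f` continuous with `|f u − f v| ≤ K Σ_i |u_i − v_i|` and `|f| ≤ G` on
the cube.  Then `|∫ f dP − ∫ f dQ| ≤ 2K·π|ι|∕m + G·(m·9^m)^{|ι|}·r` (discrete tensor Jackson quasi-interpolant of `f` at the `(2m)^{|ι|}` nodes `(cos(πa_i∕m))_i`: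
`πK|ι|∕m`-close to `f` on the cube — module 60 —, priced at the moments by §3). -/
theorem abs_integral_sub_integral_le_of_mixedMoments_jackson {P Q : Measure (ι → ℝ)} [IsProbabilityMeasure P] [IsProbabilityMeasure Q]
    (hP : P (Set.pi Set.univ (fun _ : ι => Set.Icc (-1 : ℝ) 1))ᶜ = 0) (hQ : Q (Set.pi Set.univ (fun _ : ι => Set.Icc (-1 : ℝ) 1))ᶜ = 0)
    {m : ℕ} (hm : 0 < m) {r : ℝ} (hr : 0 ≤ r)
    (hmom : ∀ j : ι → Fin (2 * m + 1), |∫ x, ∏ i, x i ^ (j i : ℕ) ∂P - ∫ x, ∏ i, x i ^ (j i : ℕ) ∂Q| ≤ r)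
    {f : (ι → ℝ) → ℝ} (hf : Continuous f) {K G : ℝ} (hK0 : 0 ≤ K)
    (hK : ∀ u v : ι → ℝ, (∀ i, u i ∈ Set.Icc (-1 : ℝ) 1) → (∀ i, v i ∈ Set.Icc (-1 : ℝ) 1) → |f u - f v| ≤ K * ∑ i, |u i - v i|)
    (hG : ∀ u : ι → ℝ, (∀ i, u i ∈ Set.Icc (-1 : ℝ) 1) → |f u| ≤ G) :
    |∫ x, f x ∂P - ∫ x, f x ∂Q| ≤ 2 * K * (π * Fintype.card ι / m) + G * (m * 9 ^ m) ^ Fintype.card ι * r := by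
  classical
  have hN : 0 < 2 * m := by omega
  -- the node polynomials and the quasi-interpolant `T`
  set Φ : ℕ → ℝ[X] := fun b => C (1 / (((2 * m : ℕ) : ℝ) * (m * (2 * m ^ 2 + 1) / 3))) *
      ∑ y ∈ (range m ×ˢ range m) ×ˢ (range m ×ˢ range m),
        C (Real.cos ((((y.1.1 : ℤ) - y.1.2 + y.2.1 - y.2.2 : ℤ) : ℝ) * (2 * π * b / (2 * m : ℕ)))) *
          Chebyshev.T ℝ ((y.1.1 : ℤ) - y.1.2 + y.2.1 - y.2.2) with hΦ
  set T : (ι → ℝ) → ℝ := fun x => ∑ a : ι → Fin (2 * m), f (fun i => Real.cos (2 * π * (a i : ℕ) / (2 * m : ℕ))) *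
      ∏ i, (Φ (a i)).eval (x i) with hTdef
  have hTc : Continuous T := continuous_finsetSum _ fun a _ => continuous_const.mul
    (continuous_finsetProd _ fun i _ => (Polynomial.continuous _).comp (continuous_apply i))
  have hnode : ∀ a : ι → Fin (2 * m), ∀ i, Real.cos (2 * π * (a i : ℕ) / (2 * m : ℕ)) ∈ Set.Icc (-1 : ℝ) 1 := fun a i =>
    ⟨Real.neg_one_le_cos _, Real.cos_le_one _⟩
  -- approximation on the cube: `|T x − f x| ≤ Kπ|ι|∕m`
  have happrox : ∀ x : ι → ℝ, (∀ i, x i ∈ Set.Icc (-1 : ℝ) 1) → |T x - f x| ≤ K * (π * Fintype.card ι / m) := by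
    intro x hx
    have h := abs_tensorJackson_sub_le_cube hK0 hK hm (le_refl (2 * m)) hx
    have hT : T x = ∑ a : ι → Fin (2 * m), f (fun i => Real.cos (2 * π * (a i : ℕ) / (2 * m : ℕ))) * ∏ i,
        ((∑ j₁ ∈ range m, ∑ j₂ ∈ range m, Real.cos (((j₁ : ℝ) - j₂) * (Real.arccos (x i) - 2 * π * (a i : ℕ) / (2 * m : ℕ)))) ^ 2 +
            (∑ j₁ ∈ range m, ∑ j₂ ∈ range m, Real.cos (((j₁ : ℝ) - j₂) * (Real.arccos (x i) + 2 * π * (a i : ℕ) / (2 * m : ℕ)))) ^ 2) /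
          (2 * (2 * m : ℕ) * (m * (2 * m ^ 2 + 1) / 3)) := by
      simp only [hTdef]
      refine Finset.sum_congr rfl fun a _ => ?_
      congr 1
      refine Finset.prod_congr rfl fun i _ => ?_
      have e := eval_jacksonPoly_cos m (2 * m) (a i) (Real.arccos (x i))
      rw [Real.cos_arccos (hx i).1 (hx i).2] at e
      exact e
    rw [hT]
    exact h
  -- the two approximation errors under `P` and `Q`
  have herr : ∀ (μ₀ : Measure (ι → ℝ)) [IsProbabilityMeasure μ₀], μ₀ (Set.pi Set.univ (fun _ : ι => Set.Icc (-1 : ℝ) 1))ᶜ = 0 →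
      |∫ x, f x ∂μ₀ - ∫ x, T x ∂μ₀| ≤ K * (π * Fintype.card ι / m) := by
    intro μ₀ _ hR
    have hsub : ∫ x, f x ∂μ₀ - ∫ x, T x ∂μ₀ = ∫ x, (f x - T x) ∂μ₀ :=
      (integral_sub (integrable_of_continuous_of_cube hR hf) (integrable_of_continuous_of_cube hR hTc)).symm
    have hae : ∀ᵐ x ∂μ₀, x ∈ Set.pi Set.univ (fun _ : ι => Set.Icc (-1 : ℝ) 1) := mem_ae_iff.2 hR
    rw [hsub, ← Real.norm_eq_abs]
    refine (norm_integral_le_of_norm_le_const (hae.mono fun x hx => ?_)).trans (by rw [probReal_univ, mul_one])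
    rw [Real.norm_eq_abs, abs_sub_comm]
    exact happrox x fun i => Set.mem_univ_pi.1 hx i
  -- pricing the polynomial at the moments
  have hprice : |∫ x, T x ∂P - ∫ x, T x ∂Q| ≤ G * (m * 9 ^ m) ^ Fintype.card ι * r :=
    abs_integral_tensorJackson_sub_le hP hQ hm hN hr hmom
      (c := fun a : ι → Fin (2 * m) => f (fun i => Real.cos (2 * π * (a i : ℕ) / (2 * m : ℕ)))) fun a => hG _ (hnode a)
  have hPe := herr P hP
  have hQe := herr Q hQ
  rw [abs_sub_comm] at hQe
  calc |∫ x, f x ∂P - ∫ x, f x ∂Q|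
      = |(∫ x, f x ∂P - ∫ x, T x ∂P) + (∫ x, T x ∂P - ∫ x, T x ∂Q) + (∫ x, T x ∂Q - ∫ x, f x ∂Q)| := by ring_nf
    _ ≤ |∫ x, f x ∂P - ∫ x, T x ∂P| + |∫ x, T x ∂P - ∫ x, T x ∂Q| + |∫ x, T x ∂Q - ∫ x, f x ∂Q| := abs_add_three _ _ _
    _ ≤ K * (π * Fintype.card ι / m) + G * (m * 9 ^ m) ^ Fintype.card ι * r + K * (π * Fintype.card ι / m) := by
        linarith
    _ = 2 * K * (π * Fintype.card ι / m) + G * (m * 9 ^ m) ^ Fintype.card ι * r := by ring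

end Summit.QuantumFields.YangMills.Theorems.BalabanUVNodesN19DiscreteJacksonPricing

end
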